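/-
Copyright (c) 2026 the pub-hodgecm-mathlib formalisation cell (harness21).  Prover seat hodgecm-mathlib-K2E4-p14 (g7): Track B «K2-LIT», ENGINE E1,
h413 = stmt-HodgeConjecture-24833; RULING (57)(ii) of K2E1-plan (g6): «(L3) ON {1 < re} — W5₃-B at the local abscissa σ₁ = 1».
-/
import Summits.HodgeConjecture.HodgeConjecture.Theorems.K2E1SphericalConstantTermContinuationU3        -- ★ (this seat): the core `sphericalConstantTerm_continuation_cm_three_of_local` (abscissa binder `hloc`)
import Summits.HodgeConjecture.HodgeConjecture.Theorems.K2E1IntertwiningLocalFactorBadPlaceSplitU3    -- ★ p859411 (K2E2-p12 g5, (L3-bad)): `integrable_localHeight_rpow_neg` — `Q_v^{−σ} ∈ L¹(ν³)` at EVERY place for EVERY `σ > 1`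
import HarnessLib

/-!
# K2·E1 — `K2E1SphericalConstantTermContinuationCMThree` ((L3) OF THE `N = 3` CAPSTONE, LETTER-FREE): THE SPHERICAL CONSTANT-TERM SCALAR OF `U(2,1)_{L∕L⁺}` CONTINUES
# MEROMORPHICALLY TO `{Re z > 1}` WITH EXACTLY ONE POLE, SIMPLE, AT `z = 2`

Track B ∕ K2-LIT, crux h413 = `stmt-HodgeConjecture-24833`, route of record `HCCMUnconditional`; cell `hodgecm-mathlib`, squad K2, ENGINE E1 (campaign «EIS-RANK-ONE», R7 at `N = 3`).
THEOREMS ONLY (no `def`, no instance, no notation, no named-fact hypothesis, no `sorry`; default heartbeats); lane `--supports stmt-HodgeConjecture-24833 --as helper` (count-neutral).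
The core ★ `K2E1SphericalConstantTermContinuationU3.sphericalConstantTerm_continuation_cm_three_of_local` at the local abscissa `σ₁ = 1`, its binder `hloc` DISCHARGED by ★ (L3-bad)
`K2E1IntertwiningLocalFactorBadPlaceSplitU3.integrable_localHeight_rpow_neg` (K2E2-p12 (g5): the `U(2,1)` local intertwining integrand is `ν_v³`-integrable at EVERY finite place of `L⁺` for
EVERY real `σ > 1` — split places by the general-Jacobian big-cell change onto Gindikin–Karpelevich, non-split places by the model-cell comparison).
* **`sphericalConstantTerm_continuation_cm_three_one (hcδ) (hδ) (ν) [IsHaarMeasure] (h𝓕N) (h𝓕c)`** (HEAD) :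
  `∃ c r, r ≠ 0 ∧ MeromorphicOn c {1 < re} ∧ DifferentiableOn ℂ c ({1 < re} ∖ {2}) ∧ Tendsto (fun z => (z − 2) * c z) (𝓝[≠] 2) (𝓝 r) ∧ ∀ z, 2 < z.re → c z = ν(𝓕)⁻¹·∫ (H(ι(w₀)v) : ℂ)^z dν`
  — the letters (L3) `c r hr hcmer hchol hcres` of ★ capstone₃ `K2E1SphericalEisensteinContinuationCMThreeOfLetters.sphericalEisenstein_continuation_cm_three_of_letters` VERBATIM
  (`U = {1 < re}`, `ρ₀ = 2`), plus the identification with the scalar on `{2 < re}` that the (L4) payer needs.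
HONEST LABEL: HC_CM is proved only modulo the 7 printed citations (2 remaining named inputs: hLiu418 = `stmt-HodgeConjecture-24832`, h413 = `stmt-HodgeConjecture-24833`) until rung 0
closes; this file asserts no named fact and closes no socket; count-neutral; unconditional.

## References
* [MoeglinWaldspurger1995] C. Mœglin, J.-L. Waldspurger, *Spectral Decomposition and Eisenstein Series* (1995): II.1.7, IV.1.11.
* [Langlands1976] R. P. Langlands, *On the Functional Equations Satisfied by Eisenstein Series*, LNM 544 (1976): Appendix.
-/

set_option autoImplicit false
set_option linter.dupNamespace false -- the mandated namespace repeats `HodgeConjecture.HodgeConjecture`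

noncomputable section

open MeasureTheory MeasureTheory.Measure NumberField IsDedekindDomain Set Filter Topology
open scoped ENNReal NNReal
open Literature.NumberTheory.Automorphic Literature.NumberTheory.Automorphic.UnitaryGroup AdelicGroupData
open Literature.NumberTheory.GaloisRepresentations.IsNonarchimedeanLocalField
open Summit.HodgeConjecture.HodgeConjecture.Cruxes.H413
open Summit.HodgeConjecture.HodgeConjecture.Cruxes.H413.K2E1SphericalConstantTermContinuationU3 (sphericalConstantTerm_continuation_cm_three_of_local)
open Summit.HodgeConjecture.HodgeConjecture.Cruxes.H413.K2E1IntertwiningLocalFactorBadPlaceSplitU3 (integrable_localHeight_rpow_neg)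

namespace Summit.HodgeConjecture.HodgeConjecture.Cruxes.H413.K2E1SphericalConstantTermContinuationCMThree

variable (L : Type) [Field L] [NumberField L] [IsCMField L]
  [MeasurableSpace (quasiSplit (↥(maximalRealSubfield L)) L (IsCMField.complexConj L) 3).Adelic] [BorelSpace (quasiSplit (↥(maximalRealSubfield L)) L (IsCMField.complexConj L) 3).Adelic]

/-- **(L3), LETTER-FREE — W5₃-B ON `{Re z > 1}`.**  For the CM pair `L ∕ L⁺`, `δ ∈ L⁻ ∖ 0`, every Haar measure `ν` on `N(𝔸_{L⁺})` and every fundamental domain `𝓕` of `N(L⁺)` with compact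
closure there are `c̃ : ℂ → ℂ` and `r ≠ 0`: `c̃` meromorphic on `{1 < re}`, holomorphic on `{1 < re} ∖ {2}`, `(z − 2)·c̃(z) → r` (`z → 2`, `z ≠ 2`), and `c̃(z) = ν(𝓕)⁻¹·∫_{N(𝔸)} (H(ι(w₀)v) : ℂ)^z dν`
for `Re z > 2` — ★ core at `σ₁ = 1` with `hloc :=` ★ (L3-bad) `integrable_localHeight_rpow_neg`.  The pole at `z = 2ρ_H = 2` is the only one on `{1 < re}`.
[cite: MoeglinWaldspurger1995, IV.1.11] [cite: Langlands1976, Appendix] -/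
theorem sphericalConstantTerm_continuation_cm_three_one {δ : L} (hcδ : IsCMField.complexConj L δ = -δ) (hδ : δ ≠ 0)
    (ν : Measure ↥(adelicUnipotent (↥(maximalRealSubfield L)) L (IsCMField.complexConj L) 3)) [ν.IsHaarMeasure]
    {𝓕 : Set ↥(adelicUnipotent (↥(maximalRealSubfield L)) L (IsCMField.complexConj L) 3)} (h𝓕N : IsFundamentalDomain ↥(rationalUnipotent (↥(maximalRealSubfield L)) L (IsCMField.complexConj L) 3) 𝓕 ν)
    (h𝓕c : IsCompact (closure 𝓕)) :
    ∃ c : ℂ → ℂ, ∃ r : ℂ, r ≠ 0 ∧ MeromorphicOn c {z : ℂ | 1 < z.re} ∧ DifferentiableOn ℂ c ({z : ℂ | 1 < z.re} \ {2}) ∧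
      Tendsto (fun z : ℂ => (z - 2) * c z) (𝓝[≠] 2) (𝓝 r) ∧
      ∀ z : ℂ, 2 < z.re → c z = ((((ν 𝓕).toReal⁻¹ : ℝ)) : ℂ) * ∫ v : ↥(adelicUnipotent (↥(maximalRealSubfield L)) L (IsCMField.complexConj L) 3), (((borelHeight (((quasiSplit (↥(maximalRealSubfield L)) L (IsCMField.complexConj L) 3).toAdelic (weylLongU ((IsCMField.complexConj L : L ≃ₐ[↥(maximalRealSubfield L)] L) : L →+* L) (rfl : (StdForm.antidiagonal 3).over L = (StdForm.antidiagonal 3).over L))) * (v : (quasiSplit (↥(maximalRealSubfield L)) L (IsCMField.complexConj L) 3).Adelic))) : ℝ) : ℂ) ^ z ∂ν := by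
  have hdmem : δ * δ ∈ maximalRealSubfield L := by
    rw [← IsCMField.complexConj_eq_self_iff, map_mul, hcδ, neg_mul_neg]
  have hd : δ * δ = algebraMap ↥(maximalRealSubfield L) L ⟨δ * δ, hdmem⟩ := rfl
  have h := sphericalConstantTerm_continuation_cm_three_of_local L hcδ hδ (le_refl (1 : ℝ)) (by norm_num)
    (fun v _ _ νv _ σ hσ => integrable_localHeight_rpow_neg L hcδ hδ hd v νv hσ) ν h𝓕N h𝓕c
  simpa only using h

/-- **(L3) IN THE CAPSTONE'S BINDER ORDER** (`c r hr hcmer hchol hcres` of ★ `sphericalEisenstein_continuation_cm_three_of_letters`, without the identification clause). [cite: MoeglinWaldspurger1995, IV.1.11] -/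
theorem exists_letters_L3_cm_three {δ : L} (hcδ : IsCMField.complexConj L δ = -δ) (hδ : δ ≠ 0)
    (ν : Measure ↥(adelicUnipotent (↥(maximalRealSubfield L)) L (IsCMField.complexConj L) 3)) [ν.IsHaarMeasure]
    {𝓕 : Set ↥(adelicUnipotent (↥(maximalRealSubfield L)) L (IsCMField.complexConj L) 3)} (h𝓕N : IsFundamentalDomain ↥(rationalUnipotent (↥(maximalRealSubfield L)) L (IsCMField.complexConj L) 3) 𝓕 ν)
    (h𝓕c : IsCompact (closure 𝓕)) :
    ∃ c : ℂ → ℂ, ∃ r : ℂ, r ≠ 0 ∧ MeromorphicOn c {z : ℂ | 1 < z.re} ∧ DifferentiableOn ℂ c ({z : ℂ | 1 < z.re} \ {2}) ∧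
      Tendsto (fun z : ℂ => (z - 2) * c z) (𝓝[≠] 2) (𝓝 r) := by
  obtain ⟨c, r, hr, hmer, hhol, hres, -⟩ := sphericalConstantTerm_continuation_cm_three_one L hcδ hδ ν h𝓕N h𝓕c
  exact ⟨c, r, hr, hmer, hhol, hres⟩

end Summit.HodgeConjecture.HodgeConjecture.Cruxes.H413.K2E1SphericalConstantTermContinuationCMThree

end
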